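import Mathlib
import HarnessLib
import Summits.ResolutionOfSingularities.ResolutionOfSingularities.Theorems.WildQuotientsWildQuotientResolutionKSCentreMonoidalTransform

/-!
# The equivariant monoidal transform WITH ITS LOCALISATION DATUM (Kollár–Szabó going down, (K2-centres), local form)
# (crux `WildQuotients.WildQuotientResolution`, stub `stub_phaseZeroHighDim`)

Crux stmt-ResolutionOfSingularities-15640 (`WildQuotientResolution`), registered stub `stub_phaseZeroHighDim`;
programme PHASE0-KS-EIGENLINE, item (K2-centres-stalk). ✓`CentreChart.exists_equivariant_monoidalTransform` (p830738)
returns the monoidal transform `R₁ = S[J/y_i]_𝔫` existentially; the stalk identification `𝒪_{X',x'} ≅ R₁`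
(✓`CentreChart.nonempty_stalk_ringEquiv_of_localizedChart`, p831029) needs in addition that `R₁` is a LOCALISATION of
the chart ring: every `z ∈ R₁` is `a/b` with `a, b ∈ S[J/y_i]`, `b⁻¹ ∈ R₁`. This file re-exports the theorem with that
conjunct (`exists_equivariant_monoidalTransform_frac`; proof verbatim, read off ✓`mem_ofPrime_iff`).

[OURS · crux stmt-ResolutionOfSingularities-15640 · helper toward `stub_phaseZeroHighDim` ((K2-centres), local form;
NOT a proof of the stub); folklore, counted 0; AI-level work, weaker than expert review.] [folklore]
-/

-- single-problem summit: the doubled namespace component `ResolutionOfSingularities` is forced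
set_option linter.dupNamespace false

noncomputable section

namespace Summit.ResolutionOfSingularities.ResolutionOfSingularities.Theorems.WildQuotientResolution.CentreChart

open IsLocalRing Literature.AlgebraicGeometry.Resolution
open Summit.ResolutionOfSingularities.ResolutionOfSingularities.Theorems.WildQuotientResolution
open Summit.ResolutionOfSingularities.ResolutionOfSingularities.Theorems.SwitchingDichotomy.ChartRsop
  (le_closure_chart div_mem_closure_chart)

universe u

variable {K : Type u} [Field K]

/-- **The equivariant monoidal transform along a stable normal hyperplane (Kollár–Szabó going down, (K2-centres),
local form).** Let `S ⊆ K` be a LOCAL subring, `y` a QUASI-REGULAR family of non-units with `y_i ≠ 0` and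
`J = (y)` (adapted coordinates of a regular stable centre: `t = y_i ∉ W`, `y_j ∈ W`), and
`W ≤ (y_j : j ≠ i) + 𝔪J` (the stable hyperplane of the fibre `J/𝔪J`). Let a family `σ_h` of automorphisms of `K`
preserve `S`, act RESIDUE-TRIVIALLY on `S`, map the `y_j` (`j ≠ i`) into `W` and satisfy `σ_h y_i ≡ u_h y_i (mod W)`
with `u_h` a unit. Then there is a local subring `R₁ ⊆ K` — the monoidal transform `S[J/y_i]_𝔫` at the origin
`[W]` of the chart `D₊(y_i)` of `Bl_J Spec S` (✓`exists_centreChartOrigin`) — which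
* contains `S` and DOMINATES it: `s ∈ 𝔪_S` iff `s` is a non-unit of `R₁` (zero or inverse outside);
* makes `J` principal, generated by `y_i`: `c/y_i ∈ R₁` for `c ∈ J`, with `y_i` and the `y_j/y_i` non-units;
* is `σ_h`-STABLE for every `h` — `[W]` is an `H`-fixed point of the blow-up along the centre;
* carries a RESIDUE-TRIVIAL action again (`σ_h z − z` a non-unit) and has the SAME RESIDUE FIELD as `S`;
* is a LOCALISATION of the chart ring `S[J/y_i]` (`z = a/b`, `a, b ∈ S[J/y_i]`, `b⁻¹ ∈ R₁` — the datum consumed by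
  ✓`CentreChart.stalkClosedPointTo_surjective_of_localizedChart`);
* is a REGULAR local ring as soon as the chart ring `S[J/y_i]` is a regular ring (✓`isRegularRing_closure_monoidalChart`
  when `S` is regular and `y` is part of a regular system of parameters; ✓`KSGoingDown.isRegularLocalRing_ofPrime`).
[cite: ReichsteinYoussin2000, Appendix, Prop. A.2] [cite: Liu2002, Thm. 8.1.19 (a)] -/
theorem exists_equivariant_monoidalTransform_frac (S : Subring K) [IsLocalRing S] {r : ℕ} (y : Fin r → S)
    (hqr : IsQuasiRegular y) (hym : ∀ j, y j ∈ maximalIdeal S) (i : Fin r) (hyi : y i ≠ 0)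
    {W : Ideal S} (hWle : W ≤ Ideal.span (y '' {j | j ≠ i}) ⊔ maximalIdeal S * Ideal.span (Set.range y))
    {H : Type*} (σ : H → K ≃+* K) (hσS : ∀ h : H, ∀ s ∈ S, σ h s ∈ S)
    (hres : ∀ (h : H) (s : S), (⟨σ h s, hσS h s s.2⟩ : S) - s ∈ maximalIdeal S)
    (hWσ : ∀ (h : H) (j : Fin r), j ≠ i → (⟨σ h ((y j : S) : K), hσS h _ (y j).2⟩ : S) ∈ W)
    (ht : ∀ h : H, ∃ u : S, IsUnit u ∧ (⟨σ h ((y i : S) : K), hσS h _ (y i).2⟩ : S) - u * y i ∈ W) :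
    ∃ R₁ : LocalSubring K,
      S ≤ R₁.toSubring ∧
      (∀ s : S, s ∈ maximalIdeal S ↔ ((s : K) = 0 ∨ ((s : K))⁻¹ ∉ R₁.toSubring)) ∧
      (((y i : S) : K))⁻¹ ∉ R₁.toSubring ∧
      (∀ c : S, c ∈ Ideal.span (Set.range y) → (c : K) / ((y i : S) : K) ∈ R₁.toSubring) ∧
      (∀ j : Fin r, j ≠ i → ((y j : S) : K) / ((y i : S) : K) = 0 ∨
        (((y j : S) : K) / ((y i : S) : K))⁻¹ ∉ R₁.toSubring) ∧
      (∀ h : H, ∀ z ∈ R₁.toSubring, σ h z ∈ R₁.toSubring) ∧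
      (∀ h : H, ∀ z ∈ R₁.toSubring, σ h z - z = 0 ∨ (σ h z - z)⁻¹ ∉ R₁.toSubring) ∧
      (∀ z ∈ R₁.toSubring, ∃ s ∈ S, z - s = 0 ∨ (z - s)⁻¹ ∉ R₁.toSubring) ∧
      (IsRegularRing (Subring.closure ((S : Set K) ∪ Set.range fun j => ((y j : S) : K) / ((y i : S) : K))) →
        IsRegularLocalRing R₁.toSubring) ∧
      (∀ z ∈ R₁.toSubring, ∃ a ∈ Subring.closure ((S : Set K) ∪ Set.range fun j => ((y j : S) : K) / ((y i : S) : K)),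
        ∃ b ∈ Subring.closure ((S : Set K) ∪ Set.range fun j => ((y j : S) : K) / ((y i : S) : K)),
          b⁻¹ ∈ R₁.toSubring ∧ z = a / b) := by
  classical
  let C : Subring K := Subring.closure ((S : Set K) ∪ Set.range fun j => ((y j : S) : K) / ((y i : S) : K))
  have ht0 : ((y i : S) : K) ≠ 0 := fun h => hyi (Subtype.ext h)
  have hSC : S ≤ C := le_closure_chart S y i
  have hJC : ∀ c : S, c ∈ Ideal.span (Set.range y) → (c : K) / ((y i : S) : K) ∈ C := fun c hc =>
    div_mem_closure_chart_of_mem_span S y i hc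
  obtain ⟨𝔫, hmax, hni, hnj, hover, hcong⟩ := exists_centreChartOrigin S y hqr hym i hyi
  haveI : 𝔫.IsPrime := hmax.isPrime
  have hCR₁ : C ≤ (LocalSubring.ofPrime C 𝔫).toSubring := LocalSubring.le_ofPrime _ 𝔫
  have hnj' : ∀ j : Fin r, j ≠ i → ∀ hB : ((y j : S) : K) / ((y i : S) : K) ∈ C, (⟨_, hB⟩ : C) ∈ 𝔫 :=
    fun j hj _ => hnj j hj
  -- the claim, for each `σ h`
  have claim : ∀ (h : H) {z : K}, z ∈ C →
      σ h z ∈ (LocalSubring.ofPrime C 𝔫).toSubring ∧ ∃ b s : C, b ∈ 𝔫 ∧ s ∉ 𝔫 ∧ σ h z - z = b / s :=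
    fun h z hz => sigma_mem_ofPrime_of_mem_closure S y i hyi 𝔫 hnj' hover hWle (σ h) (hσS h)
      (hres h) (hWσ h) (ht h) hz
  refine ⟨LocalSubring.ofPrime C 𝔫, hSC.trans hCR₁, fun s => ?_, ?_, fun c hc => hCR₁ (hJC c hc),
    fun j hj => ?_, fun h z hz => ?_, fun h z hz => ?_, fun z hz => ?_, fun hreg => ?_, fun z hz => ?_⟩
  · -- domination
    constructor
    · intro hs
      exact eq_zero_or_inv_not_mem_of_frac (exists_frac_of_mem ((hover s).mpr hs))
    · rintro (h0 | hinv)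
      · exact (mem_maximalIdeal_iff_inv_not_mem s).mpr (Or.inl h0)
      · exact (mem_maximalIdeal_iff_inv_not_mem s).mpr (Or.inr fun h => hinv (hCR₁ (hSC h)))
  · -- `y_i` is a non-unit
    rcases eq_zero_or_inv_not_mem_of_frac (exists_frac_of_mem hni) with h0 | h
    · exact absurd h0 ht0
    · exact h
  · exact eq_zero_or_inv_not_mem_of_frac (exists_frac_of_mem (hnj j hj))
  · -- stability
    obtain ⟨a, s, hs, rfl⟩ := mem_ofPrime_iff.mp hz
    have hσs : σ h (s : K) = (s : K) + (σ h (s : K) - s) := by ring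
    have hinv : (σ h (s : K))⁻¹ ∈ (LocalSubring.ofPrime C 𝔫).toSubring := by
      rw [hσs]
      exact inv_add_mem_ofPrime hs (claim h s.2).2
    rw [map_div₀, div_eq_mul_inv]
    exact mul_mem (claim h a.2).1 hinv
  · -- residue-triviality
    obtain ⟨a, s, hs, rfl⟩ := mem_ofPrime_iff.mp hz
    have hs0 : ((s : C) : K) ≠ 0 := coe_ne_zero_of_not_mem hs
    have hσs0 : σ h (s : K) ≠ 0 := (map_ne_zero_iff _ (σ h).injective).mpr hs0
    have hσs : σ h (s : K) = (s : K) + (σ h (s : K) - s) := by ring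
    have hinv : (σ h (s : K))⁻¹ ∈ (LocalSubring.ofPrime C 𝔫).toSubring := by
      rw [hσs]
      exact inv_add_mem_ofPrime hs (claim h s.2).2
    have e : σ h ((a : K) / s) - (a : K) / s =
        ((σ h (a : K) - a) * s - a * (σ h (s : K) - s)) * ((σ h (s : K))⁻¹ * (s : K)⁻¹) := by
      rw [map_div₀]
      field_simp
      ring
    rw [e]
    refine eq_zero_or_inv_not_mem_of_frac (frac_mul_right ?_ (mul_mem hinv (inv_mem_ofPrime hs)))
    exact frac_sub (frac_mul_right (claim h a.2).2 (hCR₁ s.2)) (frac_mul_left (hCR₁ a.2) (claim h s.2).2)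
  · -- same residue field
    obtain ⟨a, s, hs, rfl⟩ := mem_ofPrime_iff.mp hz
    have hs0 : ((s : C) : K) ≠ 0 := coe_ne_zero_of_not_mem hs
    obtain ⟨sa, hsa⟩ := hcong a
    obtain ⟨sb, hsb⟩ := hcong s
    have hsbm : sb ∉ maximalIdeal S := fun hm => by
      have h1 : s ∈ 𝔫 := by
        have e : s = (s - ⟨(sb : K), hSC sb.2⟩) + ⟨(sb : K), hSC sb.2⟩ := by ring
        rw [e]; exact add_mem hsb ((hover sb).mpr hm)
      exact hs h1
    have hsb0 : (sb : K) ≠ 0 := by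
      intro h0
      apply hsbm
      rw [show sb = 0 from Subtype.ext h0]
      exact (maximalIdeal S).zero_mem
    have hsbinv : (sb : K)⁻¹ ∈ S := by
      by_contra hni'
      exact hsbm ((mem_maximalIdeal_iff_inv_not_mem sb).mpr (Or.inr hni'))
    refine ⟨(sa : K) * (sb : K)⁻¹, mul_mem sa.2 hsbinv, ?_⟩
    have e : (a : K) / s - (sa : K) * (sb : K)⁻¹ =
        (((a : K) - sa) * sb - sa * ((s : K) - sb)) * ((s : K)⁻¹ * (sb : K)⁻¹) := by
      field_simp
      ring
    rw [e]
    refine eq_zero_or_inv_not_mem_of_frac (frac_mul_right ?_ (mul_mem (inv_mem_ofPrime hs) (hCR₁ (hSC hsbinv))))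
    refine frac_sub (frac_mul_right (exists_frac_of_mem hsa) (hCR₁ (hSC sb.2)))
      (frac_mul_left (hCR₁ (hSC sa.2)) (exists_frac_of_mem hsb))
  · -- regularity
    haveI := hreg
    exact KSGoingDown.isRegularLocalRing_ofPrime C 𝔫
  · -- `R₁` is a localisation of the chart ring
    obtain ⟨a, s, hs, rfl⟩ := mem_ofPrime_iff.mp hz
    exact ⟨a, a.2, s, s.2, inv_mem_ofPrime hs, rfl⟩

end Summit.ResolutionOfSingularities.ResolutionOfSingularities.Theorems.WildQuotientResolution.CentreChart

end
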